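import Mathlib.MeasureTheory.Measure.LevyConvergence
import Mathlib.MeasureTheory.Measure.CharacteristicFunction.Basic
import Mathlib.Probability.Distributions.Gaussian.Real
import Mathlib.Analysis.SpecialFunctions.Integrals.Basic

/-!
# The method of moments (limits with exponential moments, e.g. Gaussian)

**Theorem (classical, the *method of moments*).** Let `μ_n`, `ν` be probability measures on `ℝ`,
`ν` having all exponential moments (`∫ e^{sx} dν < ∞` for all `s`; e.g. a Gaussian). If all moments
of `μ_n` converge to those of `ν`, then `μ_n → ν` weakly. [folklore] (E.g. P. Billingsley,
*Probability and Measure*, 3rd ed. (1995), §30 — the reference `[Billingsley_1995]` invoked for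
exactly this step in H. Duminil-Copin, K. K. Kozlowski, P. Lammers, I. Manolescu, *Gaussian free
field convergence of the six-vertex model with `-1 ≤ Δ ≤ -1/2`*, arXiv:2603.06268 (2026), Part II
§3, proof of Theorem 52: "Since a normal distribution is determined by its moments, it suffices to
prove that all moments converge".) [cite: DKLM2026SixVertexGFF, Part II, §3, proof of Theorem 52]

Proof (Mathlib-only): the sharp Taylor bound `|e^{ix} - Σ_{k<n}(ix)^k/k!| ≤ |x|^n/n!` gives
`|φ_μ(t) - Σ_{k<n} (it)^k m_k(μ)/k!| ≤ |t|^n m_{|n|}(μ)/n!`; with `n = 2J` and the exponential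
moments of `ν` (`|t|^{2J} m_{2J}(ν)/(2J)! ≤ (|t|/s)^{2J} ∫(e^{sx}+e^{-sx})dν → 0`), the
characteristic functions converge pointwise, and Lévy's convergence theorem
(`MeasureTheory.ProbabilityMeasure.tendsto_iff_tendsto_charFun`) concludes.
-/

noncomputable section

open MeasureTheory ProbabilityTheory Complex Filter Topology Finset
open scoped Nat

namespace Literature.Probability.Moments

/-! ## 1. The sharp Taylor remainder of `e^{ix}` -/

/-- `R_n(x) = e^{ix} - Σ_{k<n} (ix)^k/k!`. [folklore] -/
def expIRem (n : ℕ) (x : ℝ) : ℂ := cexp (x * I) - ∑ k ∈ range n, ((x : ℂ) * I) ^ k / (k ! : ℂ)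

/-- `R_n` is continuous. [folklore] -/
theorem continuous_expIRem (n : ℕ) : Continuous (expIRem n) := by
  unfold expIRem
  fun_prop

/-- `R_{n+1}(0) = 0`. [folklore] -/
theorem expIRem_succ_zero (n : ℕ) : expIRem (n + 1) 0 = 0 := by
  simp [expIRem, Finset.sum_range_succ']

/-- `R_{n+1}' = i R_n`. [folklore] -/
theorem hasDerivAt_expIRem (n : ℕ) (x : ℝ) : HasDerivAt (expIRem (n + 1)) (I * expIRem n x) x := by
  have hlin : HasDerivAt (fun y : ℝ => (y : ℂ) * I) I x := by
    simpa using ((hasDerivAt_id x).ofReal_comp).mul_const I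
  have hexp : HasDerivAt (fun y : ℝ => cexp ((y : ℂ) * I)) (cexp ((x : ℂ) * I) * I) x := hlin.cexp
  have hterm : ∀ k : ℕ, HasDerivAt (fun y : ℝ => ((y : ℂ) * I) ^ k / (k ! : ℂ))
      ((k : ℂ) * ((x : ℂ) * I) ^ (k - 1) * I / (k ! : ℂ)) x := fun k => (hlin.pow k).div_const _
  have hsum := HasDerivAt.sum (u := range (n + 1)) fun k _ => hterm k
  have h := (hexp.sub hsum).congr_of_eventuallyEq (f₁ := expIRem (n + 1))
    (Eventually.of_forall fun y => by simp [expIRem, Finset.sum_apply])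
  refine h.congr_deriv ?_
  rw [expIRem, mul_sub, Finset.mul_sum, Finset.sum_range_succ']
  simp only [Nat.cast_zero, zero_mul, zero_div, add_zero]
  congr 1
  · ring
  · refine Finset.sum_congr rfl fun k _ => ?_
    rw [Nat.factorial_succ, Nat.cast_mul, Nat.add_sub_cancel]
    have hk : (k ! : ℂ) ≠ 0 := by exact_mod_cast (Nat.factorial_pos k).ne'
    have hk1 : ((k + 1 : ℕ) : ℂ) ≠ 0 := by exact_mod_cast Nat.succ_ne_zero k
    field_simp

/-- `R_n(-x) = conj R_n(x)`, so `|R_n(-x)| = |R_n(x)|`. [folklore] -/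
theorem norm_expIRem_neg (n : ℕ) (x : ℝ) : ‖expIRem n (-x)‖ = ‖expIRem n x‖ := by
  have h : expIRem n (-x) = (starRingEnd ℂ) (expIRem n x) := by
    simp only [expIRem, map_sub, map_sum, map_div₀, map_pow, map_mul, Complex.conj_ofReal, Complex.conj_I,
      ← Complex.exp_conj, map_natCast]
    push_cast
    ring_nf
  rw [h, Complex.norm_conj]

/-- **Sharp Taylor bound** `|e^{ix} - Σ_{k<n} (ix)^k/k!| ≤ |x|^n/n!` (Mathlib only has the
`e^{|x|}`-weighted `Complex.norm_exp_sub_sum_le_norm_mul_exp`). [folklore] -/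
theorem norm_expIRem_le (n : ℕ) (x : ℝ) : ‖expIRem n x‖ ≤ |x| ^ n / (n ! : ℝ) := by
  induction n generalizing x with
  | zero =>
    simp [expIRem, Complex.norm_exp_ofReal_mul_I]
  | succ n ih =>
    -- reduce to `0 ≤ x`
    wlog hx : 0 ≤ x generalizing x
    · have h := this (-x) (by linarith)
      rwa [norm_expIRem_neg, abs_neg] at h
    have hftc : expIRem (n + 1) x = ∫ s in (0 : ℝ)..x, I * expIRem n s := by
      rw [intervalIntegral.integral_eq_sub_of_hasDerivAt (fun s _ => hasDerivAt_expIRem n s)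
        ((continuous_const.mul (continuous_expIRem n)).intervalIntegrable _ _), expIRem_succ_zero, sub_zero]
    rw [hftc]
    calc ‖∫ s in (0 : ℝ)..x, I * expIRem n s‖ ≤ ∫ s in (0 : ℝ)..x, ‖I * expIRem n s‖ :=
          intervalIntegral.norm_integral_le_integral_norm hx
      _ ≤ ∫ s in (0 : ℝ)..x, s ^ n / (n ! : ℝ) := by
          refine intervalIntegral.integral_mono_on hx ?_
            ((by fun_prop : Continuous fun s : ℝ => s ^ n / (n ! : ℝ)).intervalIntegrable _ _) fun s hs => ?_
          · exact ((continuous_const.mul (continuous_expIRem n)).norm).intervalIntegrable _ _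
          · rw [norm_mul, Complex.norm_I, one_mul]
            have := ih s
            rwa [abs_of_nonneg hs.1] at this
      _ = |x| ^ (n + 1) / ((n + 1) ! : ℝ) := by
          rw [intervalIntegral.integral_div, integral_pow, abs_of_nonneg hx, Nat.factorial_succ]
          push_cast
          have hn : (n ! : ℝ) ≠ 0 := by exact_mod_cast (Nat.factorial_pos n).ne'
          field_simp
          ring

/-! ## 2. Taylor bound for characteristic functions -/

/-- The `k`-th term `(itx)^k/k!` is integrable when the `k`-th moment is. [folklore] -/
theorem integrable_taylorTerm {μ : Measure ℝ} (hint : ∀ k : ℕ, Integrable (fun x : ℝ => x ^ k) μ) (t : ℝ) (k : ℕ) :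
    Integrable (fun x : ℝ => (((t * x : ℝ) : ℂ) * I) ^ k / (k ! : ℂ)) μ := by
  have h : Integrable (fun x : ℝ => ((x ^ k : ℝ) : ℂ)) μ := (hint k).ofReal
  refine (h.const_mul ((((t : ℂ) * I) ^ k) / (k ! : ℂ))).congr (Eventually.of_forall fun x => ?_)
  simp only
  push_cast
  ring

/-- **`|φ_μ(t) - Σ_{k<n} (it)^k m_k/k!| ≤ |t|^n/n! ∫|x|^n dμ`** for a finite measure with moments.
[folklore] -/
theorem norm_charFun_sub_sum_le {μ : Measure ℝ} [IsFiniteMeasure μ] (hint : ∀ k : ℕ, Integrable (fun x : ℝ => x ^ k) μ)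
    (n : ℕ) (t : ℝ) :
    ‖charFun μ t - ∑ k ∈ range n, ((t : ℂ) * I) ^ k / (k ! : ℂ) * ((∫ x, x ^ k ∂μ : ℝ) : ℂ)‖ ≤
      |t| ^ n / (n ! : ℝ) * ∫ x, |x| ^ n ∂μ := by
  have hexp : charFun μ t = ∫ x, cexp (((t * x : ℝ) : ℂ) * I) ∂μ := by
    rw [charFun_apply_real]
    simp only [Complex.ofReal_mul]
  have hIexp : Integrable (fun x : ℝ => cexp (((t * x : ℝ) : ℂ) * I)) μ := by
    refine Integrable.mono' (integrable_const (1 : ℝ)) (by fun_prop) (Eventually.of_forall fun x => ?_)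
    rw [Complex.norm_exp_ofReal_mul_I]
  have hsum : ∑ k ∈ range n, ((t : ℂ) * I) ^ k / (k ! : ℂ) * ((∫ x, x ^ k ∂μ : ℝ) : ℂ)
      = ∫ x, ∑ k ∈ range n, (((t * x : ℝ) : ℂ) * I) ^ k / (k ! : ℂ) ∂μ := by
    rw [integral_finsetSum _ fun k _ => integrable_taylorTerm hint t k]
    refine Finset.sum_congr rfl fun k _ => ?_
    rw [← integral_complex_ofReal, ← integral_const_mul]
    refine integral_congr_ae (Eventually.of_forall fun x => ?_)
    simp only
    push_cast
    ring
  have hdiff : charFun μ t - ∑ k ∈ range n, ((t : ℂ) * I) ^ k / (k ! : ℂ) * ((∫ x, x ^ k ∂μ : ℝ) : ℂ) =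
      ∫ x, expIRem n (t * x) ∂μ := by
    rw [hexp, hsum, ← integral_sub hIexp (integrable_finsetSum _ fun k _ => integrable_taylorTerm hint t k)]
    rfl
  rw [hdiff]
  have hI : Integrable (fun x : ℝ => |t| ^ n / (n ! : ℝ) * |x| ^ n) μ :=
    ((hint n).abs.const_mul (|t| ^ n / (n ! : ℝ))).congr (Eventually.of_forall fun x => by
      simp only [abs_pow])
  calc ‖∫ x, expIRem n (t * x) ∂μ‖ ≤ ∫ x, ‖expIRem n (t * x)‖ ∂μ := norm_integral_le_integral_norm _
    _ ≤ ∫ x, |t| ^ n / (n ! : ℝ) * |x| ^ n ∂μ := by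
        refine integral_mono_of_nonneg (Eventually.of_forall fun x => norm_nonneg _) hI (Eventually.of_forall fun x => ?_)
        have h := norm_expIRem_le n (t * x)
        simp only
        rw [abs_mul, mul_pow] at h
        calc ‖expIRem n (t * x)‖ ≤ |t| ^ n * |x| ^ n / (n ! : ℝ) := h
          _ = |t| ^ n / (n ! : ℝ) * |x| ^ n := by ring
    _ = |t| ^ n / (n ! : ℝ) * ∫ x, |x| ^ n ∂μ := integral_const_mul _ _

/-! ## 3. Exponential moments of the limit -/

/-- Exponential moments give all polynomial moments. [folklore] -/
theorem integrable_pow_of_integrable_exp {ν : Measure ℝ} (hν : ∀ s : ℝ, Integrable (fun x => Real.exp (s * x)) ν) (k : ℕ) :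
    Integrable (fun x : ℝ => x ^ k) ν := by
  have hb : Integrable (fun x : ℝ => (k ! : ℝ) * (Real.exp (1 * x) + Real.exp (-1 * x))) ν :=
    ((hν 1).add (hν (-1))).const_mul _
  refine hb.mono' (by fun_prop) (Eventually.of_forall fun x => ?_)
  rw [Real.norm_eq_abs, abs_pow]
  have h1 : |x| ^ k / (k ! : ℝ) ≤ Real.exp |x| := Real.pow_div_factorial_le_exp (x := |x|) (abs_nonneg x) k
  have h2 : Real.exp |x| ≤ Real.exp (1 * x) + Real.exp (-1 * x) := by
    rcases le_or_gt 0 x with hx | hx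
    · rw [abs_of_nonneg hx, one_mul]
      linarith [Real.exp_pos (-1 * x)]
    · rw [abs_of_neg hx, show -x = -1 * x by ring]
      linarith [Real.exp_pos (1 * x)]
  have hk : (0 : ℝ) < k ! := by exact_mod_cast Nat.factorial_pos k
  rw [div_le_iff₀ hk] at h1
  nlinarith

/-- With exponential moments, `|t|^{2J} m_{2J}(ν)/(2J)! → 0` as `J → ∞`. [folklore] -/
theorem tendsto_pow_mul_moment_div_factorial {ν : Measure ℝ} (hν : ∀ s : ℝ, Integrable (fun x => Real.exp (s * x)) ν)
    (t : ℝ) : Tendsto (fun J : ℕ => |t| ^ (2 * J) / ((2 * J) ! : ℝ) * ∫ x, |x| ^ (2 * J) ∂ν) atTop (𝓝 0) := by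
  set s : ℝ := 2 * |t| + 2 with hs
  have hs0 : 0 < s := by positivity
  have hts : |t| / s ≤ 1 / 2 := by
    rw [div_le_iff₀ hs0, hs]
    linarith [abs_nonneg t]
  set C : ℝ := ∫ x, (Real.exp (s * x) + Real.exp (-s * x)) ∂ν with hC
  have hbound : ∀ J : ℕ, |t| ^ (2 * J) / ((2 * J) ! : ℝ) * ∫ x, |x| ^ (2 * J) ∂ν ≤ (1 / 4) ^ J * C := by
    intro J
    rw [← integral_const_mul, hC, ← integral_const_mul]
    have hI : Integrable (fun x : ℝ => |t| ^ (2 * J) / ((2 * J) ! : ℝ) * |x| ^ (2 * J)) ν :=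
      (((integrable_pow_of_integrable_exp hν (2 * J)).abs.const_mul (|t| ^ (2 * J) / ((2 * J) ! : ℝ))).congr
        (Eventually.of_forall fun x => by simp only [abs_pow]))
    refine integral_mono hI (((hν s).add (hν (-s))).const_mul _) fun x => ?_
    simp only
    have hfac : (0 : ℝ) < (2 * J) ! := by exact_mod_cast Nat.factorial_pos _
    have h1 : (s * |x|) ^ (2 * J) / ((2 * J) ! : ℝ) ≤ Real.exp (s * x) + Real.exp (-s * x) := by
      have := Real.pow_div_factorial_le_exp (x := s * |x|) (by positivity) (2 * J)
      rcases le_or_gt 0 x with hx | hx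
      · rw [abs_of_nonneg hx] at this ⊢
        linarith [Real.exp_pos (-s * x)]
      · rw [abs_of_neg hx] at this ⊢
        rw [show s * -x = -s * x by ring] at this ⊢
        linarith [Real.exp_pos (s * x)]
    have h2 : |t| ^ (2 * J) = (|t| / s) ^ (2 * J) * s ^ (2 * J) := by
      rw [div_pow, div_mul_cancel₀ _ (pow_ne_zero _ hs0.ne')]
    have h3 : (|t| / s) ^ (2 * J) ≤ (1 / 4) ^ J := by
      rw [pow_mul, show (1 / 4 : ℝ) = (1 / 2) ^ 2 by norm_num]
      exact pow_le_pow_left₀ (by positivity) (pow_le_pow_left₀ (by positivity) hts 2) J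
    calc |t| ^ (2 * J) / ((2 * J) ! : ℝ) * |x| ^ (2 * J)
        = (|t| / s) ^ (2 * J) * ((s * |x|) ^ (2 * J) / ((2 * J) ! : ℝ)) := by rw [h2, mul_pow]; ring
      _ ≤ (1 / 4) ^ J * (Real.exp (s * x) + Real.exp (-s * x)) := by
        gcongr
  have hC0 : 0 ≤ C := integral_nonneg fun x => by positivity
  refine squeeze_zero (fun J => by positivity) hbound ?_
  simpa using (tendsto_pow_atTop_nhds_zero_of_lt_one (by norm_num : (0 : ℝ) ≤ 1 / 4) (by norm_num)).mul_const C

/-! ## 4. The method of moments -/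

/-- **Convergence of moments to those of a measure with exponential moments gives convergence of
the characteristic functions.** [folklore] -/
theorem tendsto_charFun_of_tendsto_integral_pow {μ : ℕ → Measure ℝ} [∀ n, IsProbabilityMeasure (μ n)]
    {ν : Measure ℝ} [IsProbabilityMeasure ν] (hμ : ∀ n k, Integrable (fun x : ℝ => x ^ k) (μ n))
    (hν : ∀ s : ℝ, Integrable (fun x => Real.exp (s * x)) ν)
    (hmom : ∀ k : ℕ, Tendsto (fun n => ∫ x, x ^ k ∂μ n) atTop (𝓝 (∫ x, x ^ k ∂ν))) (t : ℝ) :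
    Tendsto (fun n => charFun (μ n) t) atTop (𝓝 (charFun ν t)) := by
  have hνk := integrable_pow_of_integrable_exp hν
  rw [Metric.tendsto_atTop]
  intro ε hε
  obtain ⟨J, hJ⟩ := Metric.tendsto_atTop.1 (tendsto_pow_mul_moment_div_factorial hν t) (ε / 4) (by positivity)
  have heJ : |t| ^ (2 * J) / ((2 * J) ! : ℝ) * ∫ x, |x| ^ (2 * J) ∂ν < ε / 4 := by
    have h := hJ J le_rfl
    rw [Real.dist_eq, sub_zero] at h
    exact (le_abs_self _).trans_lt h
  set K : ℕ := 2 * J with hK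
  set P : Measure ℝ → ℂ := fun ρ => ∑ k ∈ range K, ((t : ℂ) * I) ^ k / (k ! : ℂ) * ((∫ x, x ^ k ∂ρ : ℝ) : ℂ) with hP
  have hPt : Tendsto (fun n => P (μ n)) atTop (𝓝 (P ν)) :=
    tendsto_finsetSum _ fun k _ => ((Complex.continuous_ofReal.tendsto _).comp (hmom k)).const_mul _
  have habs : ∀ ρ : Measure ℝ, ∫ x, |x| ^ K ∂ρ = ∫ x, x ^ K ∂ρ := fun ρ =>
    integral_congr_ae (Eventually.of_forall fun x => by simp [hK, pow_mul, sq_abs])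
  have hm : Tendsto (fun n => |t| ^ K / (K ! : ℝ) * ∫ x, |x| ^ K ∂μ n) atTop
      (𝓝 (|t| ^ K / (K ! : ℝ) * ∫ x, |x| ^ K ∂ν)) := by
    simp_rw [habs]
    exact (hmom K).const_mul _
  obtain ⟨N₁, hN₁⟩ := Metric.tendsto_atTop.1 hPt (ε / 4) (by positivity)
  obtain ⟨N₂, hN₂⟩ := Metric.tendsto_atTop.1 hm (ε / 4) (by positivity)
  refine ⟨max N₁ N₂, fun n hn => ?_⟩
  have hb1 := norm_charFun_sub_sum_le (hμ n) K t
  have hb2 := norm_charFun_sub_sum_le hνk K t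
  have h1 := hN₁ n (le_of_max_le_left hn)
  have h2 := hN₂ n (le_of_max_le_right hn)
  rw [dist_eq_norm] at h1
  rw [Real.dist_eq] at h2
  have h2' : |t| ^ K / (K ! : ℝ) * ∫ x, |x| ^ K ∂μ n < ε / 2 := by
    have := (abs_sub_lt_iff.1 h2).1
    rw [hK] at this ⊢
    linarith
  calc dist (charFun (μ n) t) (charFun ν t) = ‖charFun (μ n) t - charFun ν t‖ := dist_eq_norm _ _
    _ ≤ ‖charFun (μ n) t - P (μ n)‖ + ‖P (μ n) - P ν‖ + ‖P ν - charFun ν t‖ := by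
        calc ‖charFun (μ n) t - charFun ν t‖
            = ‖(charFun (μ n) t - P (μ n)) + (P (μ n) - P ν) + (P ν - charFun ν t)‖ := by ring_nf
          _ ≤ ‖charFun (μ n) t - P (μ n)‖ + ‖P (μ n) - P ν‖ + ‖P ν - charFun ν t‖ := norm_add₃_le
    _ < ε := by
        rw [norm_sub_rev (P ν)]
        have hKJ : |t| ^ K / (K ! : ℝ) * ∫ x, |x| ^ K ∂ν < ε / 4 := by rw [hK]; exact heJ
        linarith

/-- **The method of moments (weak convergence).** Probability measures on `ℝ` whose moments
converge to those of a probability measure with exponential moments converge weakly to it.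
[folklore] (Billingsley 1995, §30, as invoked in [cite: DKLM2026SixVertexGFF, Part II §3, proof of
Theorem 52].) -/
theorem tendsto_of_tendsto_integral_pow {μ : ℕ → ProbabilityMeasure ℝ} {ν : ProbabilityMeasure ℝ}
    (hμ : ∀ n k, Integrable (fun x : ℝ => x ^ k) (μ n : Measure ℝ))
    (hν : ∀ s : ℝ, Integrable (fun x => Real.exp (s * x)) (ν : Measure ℝ))
    (hmom : ∀ k : ℕ, Tendsto (fun n => ∫ x, x ^ k ∂(μ n : Measure ℝ)) atTop (𝓝 (∫ x, x ^ k ∂(ν : Measure ℝ)))) :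
    Tendsto μ atTop (𝓝 ν) :=
  MeasureTheory.ProbabilityMeasure.tendsto_iff_tendsto_charFun.2 fun t =>
    tendsto_charFun_of_tendsto_integral_pow hμ hν hmom t

/-- The method of moments, tested against bounded continuous functions. [folklore] -/
theorem tendsto_integral_of_tendsto_integral_pow {μ : ℕ → ProbabilityMeasure ℝ} {ν : ProbabilityMeasure ℝ}
    (hμ : ∀ n k, Integrable (fun x : ℝ => x ^ k) (μ n : Measure ℝ))
    (hν : ∀ s : ℝ, Integrable (fun x => Real.exp (s * x)) (ν : Measure ℝ))
    (hmom : ∀ k : ℕ, Tendsto (fun n => ∫ x, x ^ k ∂(μ n : Measure ℝ)) atTop (𝓝 (∫ x, x ^ k ∂(ν : Measure ℝ))))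
    (g : BoundedContinuousFunction ℝ ℝ) :
    Tendsto (fun n => ∫ x, g x ∂(μ n : Measure ℝ)) atTop (𝓝 (∫ x, g x ∂(ν : Measure ℝ))) :=
  (MeasureTheory.ProbabilityMeasure.tendsto_iff_forall_integral_tendsto.1
    (tendsto_of_tendsto_integral_pow hμ hν hmom)) g

/-- **Gaussian case.** Probability measures on `ℝ` whose `k`-th moments converge to those of
`N(m, v)` for every `k` converge weakly to `N(m, v)`. [folklore] -/
theorem tendsto_gaussianReal_of_tendsto_integral_pow {μ : ℕ → ProbabilityMeasure ℝ} (m : ℝ) (v : NNReal)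
    (hμ : ∀ n k, Integrable (fun x : ℝ => x ^ k) (μ n : Measure ℝ))
    (hmom : ∀ k : ℕ, Tendsto (fun n => ∫ x, x ^ k ∂(μ n : Measure ℝ)) atTop (𝓝 (∫ x, x ^ k ∂gaussianReal m v))) :
    Tendsto μ atTop (𝓝 ⟨gaussianReal m v, inferInstance⟩) :=
  tendsto_of_tendsto_integral_pow hμ (fun s => integrable_exp_mul_gaussianReal s) hmom

end Literature.Probability.Moments

end
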